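import Summits.HodgeConjecture.HodgeConjecture.Theorems.F0P3cStCharTSCartanSplitTwoH       -- F-A (this seat): `not_isCompact_splitTorusH`, the `M_H` letters; brings ★ CartanFinTwo ∕ CartanAll cones
import Summits.HodgeConjecture.HodgeConjecture.Theorems.F0P3cStCharTSHypConjTwo            -- ★ p851… (LH1-p03 (g8)) (B3) «HYP-CONJ₂★»: `exists_conj_mem_torusU_of_isRoot_of_isUnit₂`
import Summits.HodgeConjecture.HodgeConjecture.Theorems.F0P3cStCharTSStableInvariantsH     -- ★ p851650 (F0P3a-p05 (g22)) (B2): `exists_isRoot_charpoly_fst_of_mem_hyperbolicSet`, `isRegularElt_fst_of_isLocalGRegular`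
import HarnessLib

/-!
# F0 · P3c · ROAD «UP-TR» (H1) — «ELL-CARTAN-COMPACT-H★»: a `G`-regular element of `H_v = U(Φ₂)(L⁺_v) × U(Φ₁)(L⁺_v)` has a compact centraliser iff
# `ι_v(γ) ∉ Ω`, and a NON-compact Cartan subgroup of `H_v` is conjugate to the split one `M_H = M₂ × U(Φ₁)(L⁺_v)` [Rogawski1990, §3.6 pp. 28–31; §12.5 pp. 182–184]

Cell `pub/hodgecm-mathlib`, crux H413 = `stmt-HodgeConjecture-24833` (lane `--supports … --as helper`), route HCCMUnconditional; ROAD «UP-TR» (LEAD T14-21 «A»,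
holder ∕ dealer F0P3-p02 (g23)), brick (H1) «CARTAN-ALL-H», FILE F-B of the census `F0/P3a/F0P3a-p03/g26/h1/CENSUS-H1-CartanAllH.v1.F0P3ap03g26.md` — (t2) of the census,
which REPLACES the planned F-B∕F-C pair: the rank-2 analysis is NOT re-walked, it is INHERITED from the rank-3 ★ road through the endoscopic embedding `ι_v` and two ★ rank-2
files found in the tree (★ (B3) `F0P3cStCharTSHypConjTwo`, ★ (B2) `F0P3cStCharTSStableInvariantsH`); seat F0P3a-p03 (g26).  THEOREMS ONLY; ★-only imports.

THE ARGUMENT.  `ι = ι_v = endoEmbLocal L v : H_v →* U(Φ₃)(L⁺_v) = Gqs L v` is a closed embedding (★ `isClosedEmbedding_endoEmbLocal`) and a homomorphism, so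
`Z_H(γ) = ι⁻¹(Z_G(ι γ))` (§1) and `Z_G(ι γ)` compact ⇒ `Z_H(γ)` compact (`IsClosedEmbedding.isCompact_preimage`).  For `γ` `G`-REGULAR (`ι γ` regular): `Z_G(ι γ)` is compact
iff `ι γ ∉ Ω` (★ rank 3 `isCompact_centralizer_iff_not_mem_hyperbolicSet`); and `ι γ ∈ Ω` iff `χ_{γ.1}` has a root `α` with `α σ(α) ≠ 1` (★ (B2) `endoEmbLocal_mem_hyperbolicSet_iff`),
in which case `γ.1 = x m x⁻¹` with `m ∈ M₂ = torusU` (★ (B3) `exists_conj_mem_torusU_of_isRoot_of_isUnit₂` over the field-like `E_v`, ★ `isUnit_of_ne_zero_of_nonsplit`),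
`Z_{H₂}(γ.1) = x M₂ x⁻¹` (★ (A1) `centralizer_eq_torusU_of_isRegularElt`) and `Z_H(γ) = Z_{H₂}(γ.1) × H₁ = (x, 1) M_H (x, 1)⁻¹` (★ `centralizer_singleton_prod_eq_prod_top`, ★
`map_conj_prod_top`) — which is NOT compact (F-A `not_isCompact_splitTorusH`).  Hence:
* §1 `centralizer_eq_comap_endoEmbLocal`, `isCompact_centralizer_of_isCompact_centralizer_endoEmbLocal`.
* §2 **`exists_centralizer_eq_map_splitTorusH_of_mem_hyperbolicSet`** — `ι γ ∈ Ω ⇒ Z_H(γ) = Ad(u) M_H`.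
* §3 **`isCompact_centralizer_iff_not_mem_hyperbolicSet_H`** — for `G`-regular `γ`: `Z_H(γ)` compact ↔ `ι γ ∉ Ω`; **`exists_centralizer_eq_map_splitTorusH_of_not_isCompact`** —
  (t2): a `G`-regular `γ` with NON-compact centraliser has `Z_H(γ) = Ad(u) M_H`.
HONEST LABEL: count-neutral; block consequents 11 → 10 → 9 only at the rider editions; organs 2 = 2; h413 registry untouched; HC_CM is proved only modulo the printed
citations until rung 0 closes.

## References
* [Rogawski1990] J. D. Rogawski, *Automorphic Representations of Unitary Groups in Three Variables*, Ann. of Math. Stud. 123 (1990): §3.6 pp. 28–31 (Cartan subgroups of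
  `U(2) × U(1)` and `U(3)`), §4.3 p. 42 (`G`-regular elements of `H`), §4.8 Case (a) p. 53 (`ι : H ⊂ G`), §12.5 pp. 182–184 (the hyperbolic set, elliptic = compact Cartans).
* [PlatonovRapinchuk1994] V. Platonov, A. Rapinchuk, *Algebraic Groups and Number Theory* (1994), §3.3, §6.4.
* [BourbakiGT1] N. Bourbaki, *General Topology* I, Ch. I §10 (proper maps; preimages of compact sets under closed embeddings).
-/

set_option autoImplicit false
-- the mandated namespace has the single-problem summit's repeated segment (`HodgeConjecture.HodgeConjecture`)
set_option linter.dupNamespace false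

noncomputable section

open NumberField IsDedekindDomain Matrix Polynomial Topology
open scoped MatrixGroups
open Literature.NumberTheory.Rogawski1990 Literature.NumberTheory.Automorphic Literature.NumberTheory.Automorphic.UnitaryGroup
open Summit.HodgeConjecture.HodgeConjecture.Cruxes.H413.F0P3cStCharTSTorusDefs
open Summit.HodgeConjecture.HodgeConjecture.Cruxes.H413.F0P3cStCharTSCartanEllProd
open Summit.HodgeConjecture.HodgeConjecture.Cruxes.H413.F0P3cStCharTSCartanSplitTwoH
open Summit.HodgeConjecture.HodgeConjecture.Cruxes.H413.F0P3cStCharTSStableInvariantsH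
open Summit.HodgeConjecture.HodgeConjecture.Cruxes.H413.F0P3cStCharTSHypConjTwo

namespace Summit.HodgeConjecture.HodgeConjecture.Cruxes.H413.F0P3cStCharTSEllCartanCompactH

variable (L : Type) [Field L] [NumberField L] [IsCMField L] (v : HeightOneSpectrum (𝓞 ↥(maximalRealSubfield L)))

/-! ## §1 `Z_H(γ) = ι⁻¹(Z_G(ι γ))`; compactness descends along the closed embedding `ι_v` -/

set_option maxHeartbeats 800000 in  -- statement-level `whnf` on the CM carriers
/-- **`Z_H(γ) = ι_v⁻¹(Z_G(ι_v γ))`**: `ι_v` is an injective homomorphism. [cite: Rogawski1990, §4.8 Case (a) p. 53; §4.3 p. 42] -/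
theorem centralizer_eq_comap_endoEmbLocal
    (γ : (UnitaryGroup.cmDatum L 2 (Matrix.of fun i j : Fin 2 => if i.val + j.val + 1 = 2 then (1 : L) else 0)).Local v ×
      (UnitaryGroup.cmDatum L 1 (Matrix.of fun i j : Fin 1 => if i.val + j.val + 1 = 1 then (1 : L) else 0)).Local v) :
    Subgroup.centralizer ({γ} : Set ((UnitaryGroup.cmDatum L 2 (Matrix.of fun i j : Fin 2 => if i.val + j.val + 1 = 2 then (1 : L) else 0)).Local v ×
      (UnitaryGroup.cmDatum L 1 (Matrix.of fun i j : Fin 1 => if i.val + j.val + 1 = 1 then (1 : L) else 0)).Local v)) =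
      (Subgroup.centralizer ({endoEmbLocal L v γ} :
        Set ((UnitaryGroup.cmDatum L 3 (Matrix.of fun i j : Fin 3 => if i.val + j.val + 1 = 3 then (1 : L) else 0)).Local v))).comap (endoEmbLocal L v) := by
  ext h
  rw [Subgroup.mem_comap, Subgroup.mem_centralizer_singleton_iff, Subgroup.mem_centralizer_singleton_iff, ← map_mul, ← map_mul]
  constructor
  · intro hh; rw [hh]
  · intro hh; exact (isClosedEmbedding_endoEmbLocal L v).injective hh

set_option maxHeartbeats 800000 in  -- statement-level `whnf` on the CM carriers
/-- **Compactness descends along `ι_v`**: if `Z_G(ι_v γ)` is compact then so is `Z_H(γ) = ι_v⁻¹(Z_G(ι_v γ))` (`ι_v` is a closed embedding, so preimages of compact sets are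
compact). [cite: Rogawski1990, §4.8 Case (a) p. 53] [cite: BourbakiGT1, Ch. I §10] -/
theorem isCompact_centralizer_of_isCompact_centralizer_endoEmbLocal
    (γ : (UnitaryGroup.cmDatum L 2 (Matrix.of fun i j : Fin 2 => if i.val + j.val + 1 = 2 then (1 : L) else 0)).Local v ×
      (UnitaryGroup.cmDatum L 1 (Matrix.of fun i j : Fin 1 => if i.val + j.val + 1 = 1 then (1 : L) else 0)).Local v)
    (hc : IsCompact ((Subgroup.centralizer ({endoEmbLocal L v γ} :
        Set ((UnitaryGroup.cmDatum L 3 (Matrix.of fun i j : Fin 3 => if i.val + j.val + 1 = 3 then (1 : L) else 0)).Local v))) :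
      Set ((UnitaryGroup.cmDatum L 3 (Matrix.of fun i j : Fin 3 => if i.val + j.val + 1 = 3 then (1 : L) else 0)).Local v))) :
    IsCompact ((Subgroup.centralizer ({γ} : Set ((UnitaryGroup.cmDatum L 2 (Matrix.of fun i j : Fin 2 => if i.val + j.val + 1 = 2 then (1 : L) else 0)).Local v ×
      (UnitaryGroup.cmDatum L 1 (Matrix.of fun i j : Fin 1 => if i.val + j.val + 1 = 1 then (1 : L) else 0)).Local v))) :
      Set ((UnitaryGroup.cmDatum L 2 (Matrix.of fun i j : Fin 2 => if i.val + j.val + 1 = 2 then (1 : L) else 0)).Local v ×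
        (UnitaryGroup.cmDatum L 1 (Matrix.of fun i j : Fin 1 => if i.val + j.val + 1 = 1 then (1 : L) else 0)).Local v)) := by
  rw [centralizer_eq_comap_endoEmbLocal, Subgroup.coe_comap]
  exact (isClosedEmbedding_endoEmbLocal L v).isCompact_preimage hc

/-! ## §2 `ι_v γ ∈ Ω ⇒ Z_H(γ)` is a conjugate of `M_H` -/

set_option maxHeartbeats 1600000 in  -- statement-level `whnf` on the CM carriers (`Gqs`, `LocalRing`), as in ★ (B2)
/-- **`ι_v(γ) ∈ Ω ⇒ Z_H(γ) = Ad(u) M_H`** (`v` non-split).  `χ_{γ.1}` has a root `α` with `α σ(α) ≠ 1` (★ (B2)), so `γ.1 = x⁻¹ m x` with `m ∈ torusU = M₂` regular (★ (B3) over the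
field-like `E_v`; `γ` is `G`-regular, ★ `isLocalGRegular_of_mem_hyperbolicSet`, hence `γ.1` is regular), `Z_{H₂}(γ.1) = Ad(x⁻¹) M₂` (★ (A1)), and
`Z_H(γ) = Z_{H₂}(γ.1) × H₁ = Ad((x⁻¹, 1)) M_H`. [cite: Rogawski1990, §3.6 pp. 28–31; §12.5 p. 182] -/
theorem exists_centralizer_eq_map_splitTorusH_of_mem_hyperbolicSet (hns : ∀ w : PlacesOver L v, IsCMField.complexConj L • w.1 = w.1)
    (γ : (UnitaryGroup.cmDatum L 2 (Matrix.of fun i j : Fin 2 => if i.val + j.val + 1 = 2 then (1 : L) else 0)).Local v ×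
      (UnitaryGroup.cmDatum L 1 (Matrix.of fun i j : Fin 1 => if i.val + j.val + 1 = 1 then (1 : L) else 0)).Local v)
    (hΩ : endoEmbLocal L v γ ∈ hyperbolicSet L v) :
    ∃ u : (UnitaryGroup.cmDatum L 2 (Matrix.of fun i j : Fin 2 => if i.val + j.val + 1 = 2 then (1 : L) else 0)).Local v ×
        (UnitaryGroup.cmDatum L 1 (Matrix.of fun i j : Fin 1 => if i.val + j.val + 1 = 1 then (1 : L) else 0)).Local v,
      Subgroup.centralizer ({γ} : Set ((UnitaryGroup.cmDatum L 2 (Matrix.of fun i j : Fin 2 => if i.val + j.val + 1 = 2 then (1 : L) else 0)).Local v ×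
        (UnitaryGroup.cmDatum L 1 (Matrix.of fun i j : Fin 1 => if i.val + j.val + 1 = 1 then (1 : L) else 0)).Local v)) =
      (Subgroup.prod (G := (UnitaryGroup.cmDatum L 2 (Matrix.of fun i j : Fin 2 => if i.val + j.val + 1 = 2 then (1 : L) else 0)).Local v)
          (N := (UnitaryGroup.cmDatum L 1 (Matrix.of fun i j : Fin 1 => if i.val + j.val + 1 = 1 then (1 : L) else 0)).Local v)
          (cmBorelTriple L 2 v).M ⊤).map (MulAut.conj u).toMonoidHom := by
  haveI : Nontrivial (LocalRing L v) := F0P3cStCharTSWeylHypCM.nontrivial_localRing L v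
  have hR := F0P3cStCharTSWeylHypCM.isUnit_of_ne_zero_of_nonsplit L v hns
  -- a root `α` of `χ_{γ.1}` with `α σ(α) ≠ 1`, and `γ.1` regular
  obtain ⟨α, hα, hne⟩ := exists_isRoot_charpoly_fst_of_mem_hyperbolicSet L v hns hΩ
  have hreg : IsRegularElt (γ.1.val : GL (Fin 2) (LocalRing L v)) :=
    isRegularElt_fst_of_isLocalGRegular L v (isLocalGRegular_of_mem_hyperbolicSet L v hΩ)
  -- conjugate `γ.1` into the split torus of `U(Φ₂)(L⁺_v)`
  let a : ↥(unitaryGroupOfForm (conjLocal L (IsCMField.complexConj L) v) (cmLocalForm L 2 v)) := γ.1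
  have hrega : IsRegularElt (a : GL (Fin 2) (LocalRing L v)) := hreg
  have hαa : (((a : GL (Fin 2) (LocalRing L v)) : Matrix (Fin 2) (Fin 2) (LocalRing L v)).charpoly).IsRoot α := hα
  obtain ⟨x, hxT, d, hd, -, -⟩ := exists_conj_mem_torusU_of_isRoot_of_isUnit₂ (conjLocal L (IsCMField.complexConj L) v) hR (conjLocal_conjLocal_cm L v)
    (cmLocalForm_eq_over L 2 v) hrega hαa hne
  -- `Z_{H₂}(x a x⁻¹) = M₂`
  have hregx : IsRegularElt (((x * a * x⁻¹ : ↥(unitaryGroupOfForm (conjLocal L (IsCMField.complexConj L) v) (cmLocalForm L 2 v))) : GL (Fin 2) (LocalRing L v))) :=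
    (F0P3cStCharTSEllipticCriterion.isRegularElt_coe_conj_iff _ _ a x).2 hrega
  have hZ : Subgroup.centralizer ({x * a * x⁻¹} : Set ↥(unitaryGroupOfForm (conjLocal L (IsCMField.complexConj L) v) (cmLocalForm L 2 v))) = (cmBorelTriple L 2 v).M :=
    F0P3cStCharTSWeylHypFibre.centralizer_eq_torusU_of_isRegularElt (conjLocal L (IsCMField.complexConj L) v) (cmLocalForm L 2 v) hxT hregx
  -- `Z_{H₂}(a) = Ad(x⁻¹) M₂`
  have hZa : Subgroup.centralizer ({a} : Set ↥(unitaryGroupOfForm (conjLocal L (IsCMField.complexConj L) v) (cmLocalForm L 2 v))) =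
      ((cmBorelTriple L 2 v).M).map (MulAut.conj x⁻¹).toMonoidHom := by
    rw [← hZ, ← F0P3cStCharTSCartanEllProd.centralizer_singleton_conj_eq_map]
    congr 2
    group
  -- `U(Φ₁)(L⁺_v)` is commutative (`1 × 1` matrices), so `Z_H((a, b)) = Z_{H₂}(a) × ⊤`
  have hcomm : ∀ p q : (UnitaryGroup.cmDatum L 1 (Matrix.of fun i j : Fin 1 => if i.val + j.val + 1 = 1 then (1 : L) else 0)).Local v, p * q = q * p := by
    intro p q
    apply Subtype.ext
    apply Units.ext
    change (p.val : GL (Fin 1) (UnitaryGroup.LocalRing L v)).val * (q.val : GL (Fin 1) (UnitaryGroup.LocalRing L v)).val =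
      (q.val : GL (Fin 1) (UnitaryGroup.LocalRing L v)).val * (p.val : GL (Fin 1) (UnitaryGroup.LocalRing L v)).val
    ext i j
    obtain rfl : i = 0 := Subsingleton.elim _ _
    obtain rfl : j = 0 := Subsingleton.elim _ _
    simp only [Matrix.mul_apply, Fin.sum_univ_one]
    exact mul_comm _ _
  refine ⟨((x⁻¹ : ↥(unitaryGroupOfForm (conjLocal L (IsCMField.complexConj L) v) (cmLocalForm L 2 v))), 1), ?_⟩
  rw [← Prod.mk.eta (p := γ), centralizer_singleton_prod_eq_prod_top hcomm]
  refine (congrArg (fun S => Subgroup.prod S ⊤) hZa).trans ?_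
  exact (map_conj_prod_top _ _ _).symm

/-! ## §3 Compact centraliser iff not hyperbolic; (t2) non-compact Cartan subgroups of `H_v` are conjugate to `M_H` -/

set_option maxHeartbeats 1600000 in  -- statement-level `whnf` on the CM carriers
/-- **COMPACT CENTRALISER ⟺ NOT HYPERBOLIC, on `H_v`**: for a `G`-regular `γ ∈ H_v` (`v` non-split), `Z_H(γ)` is compact iff `ι_v(γ) ∉ Ω`.  (←) `Z_G(ι_v γ)` is compact (★ rank 3
`isCompact_centralizer_iff_not_mem_hyperbolicSet`) and compactness descends (§1); (→) otherwise `Z_H(γ)` is a conjugate of the non-compact `M_H` (§2, F-A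
`not_isCompact_splitTorusH`). [cite: Rogawski1990, §12.5 pp. 182, 184; §3.6 pp. 28–31] -/
theorem isCompact_centralizer_iff_not_mem_hyperbolicSet_H (hns : ∀ w : PlacesOver L v, IsCMField.complexConj L • w.1 = w.1)
    (γ : (UnitaryGroup.cmDatum L 2 (Matrix.of fun i j : Fin 2 => if i.val + j.val + 1 = 2 then (1 : L) else 0)).Local v ×
      (UnitaryGroup.cmDatum L 1 (Matrix.of fun i j : Fin 1 => if i.val + j.val + 1 = 1 then (1 : L) else 0)).Local v)
    (hγ : IsLocalGRegular L v γ) :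
    IsCompact ((Subgroup.centralizer ({γ} : Set ((UnitaryGroup.cmDatum L 2 (Matrix.of fun i j : Fin 2 => if i.val + j.val + 1 = 2 then (1 : L) else 0)).Local v ×
      (UnitaryGroup.cmDatum L 1 (Matrix.of fun i j : Fin 1 => if i.val + j.val + 1 = 1 then (1 : L) else 0)).Local v))) :
      Set ((UnitaryGroup.cmDatum L 2 (Matrix.of fun i j : Fin 2 => if i.val + j.val + 1 = 2 then (1 : L) else 0)).Local v ×
        (UnitaryGroup.cmDatum L 1 (Matrix.of fun i j : Fin 1 => if i.val + j.val + 1 = 1 then (1 : L) else 0)).Local v)) ↔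
      endoEmbLocal L v γ ∉ hyperbolicSet L v := by
  constructor
  · intro hc hΩ
    obtain ⟨u, hu⟩ := exists_centralizer_eq_map_splitTorusH_of_mem_hyperbolicSet L v hns γ hΩ
    rw [hu] at hc
    exact not_isCompact_splitTorusH L v hns ((isCompact_coe_map_conj_iff _ u).1 hc)
  · intro hΩ
    have hreg : IsRegularElt ((endoEmbLocal L v γ).val : GL (Fin 3) (LocalRing L v)) := hγ
    exact isCompact_centralizer_of_isCompact_centralizer_endoEmbLocal L v γ
      ((F0P3cStCharTSEllCartanCompact.isCompact_centralizer_iff_not_mem_hyperbolicSet L v hns (γ₀ := endoEmbLocal L v γ) hreg).2 hΩ)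

set_option maxHeartbeats 1600000 in  -- statement-level `whnf` on the CM carriers
/-- **(t2) A NON-COMPACT CARTAN SUBGROUP OF `H_v` IS CONJUGATE TO THE SPLIT ONE**: a `G`-regular `γ ∈ H_v` (`v` non-split) whose centraliser is not compact has
`Z_H(γ) = Ad(u) M_H` for some `u ∈ H_v` — the rank-2 ∕ endoscopic twin of ★ `F0P3cStCharTSEllCartanCompact.exists_conj_cmTorus_of_not_isCompact_centralizer`, in the `Subgroup.map
(MulAut.conj u)` letters of ★ `exists_cartanAll`. [cite: Rogawski1990, §3.6 pp. 28–31; §12.5 pp. 182, 184] -/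
theorem exists_centralizer_eq_map_splitTorusH_of_not_isCompact (hns : ∀ w : PlacesOver L v, IsCMField.complexConj L • w.1 = w.1)
    (γ : (UnitaryGroup.cmDatum L 2 (Matrix.of fun i j : Fin 2 => if i.val + j.val + 1 = 2 then (1 : L) else 0)).Local v ×
      (UnitaryGroup.cmDatum L 1 (Matrix.of fun i j : Fin 1 => if i.val + j.val + 1 = 1 then (1 : L) else 0)).Local v)
    (hγ : IsLocalGRegular L v γ)
    (hnc : ¬ IsCompact ((Subgroup.centralizer ({γ} : Set ((UnitaryGroup.cmDatum L 2 (Matrix.of fun i j : Fin 2 => if i.val + j.val + 1 = 2 then (1 : L) else 0)).Local v ×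
      (UnitaryGroup.cmDatum L 1 (Matrix.of fun i j : Fin 1 => if i.val + j.val + 1 = 1 then (1 : L) else 0)).Local v))) :
      Set ((UnitaryGroup.cmDatum L 2 (Matrix.of fun i j : Fin 2 => if i.val + j.val + 1 = 2 then (1 : L) else 0)).Local v ×
        (UnitaryGroup.cmDatum L 1 (Matrix.of fun i j : Fin 1 => if i.val + j.val + 1 = 1 then (1 : L) else 0)).Local v))) :
    ∃ u : (UnitaryGroup.cmDatum L 2 (Matrix.of fun i j : Fin 2 => if i.val + j.val + 1 = 2 then (1 : L) else 0)).Local v ×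
        (UnitaryGroup.cmDatum L 1 (Matrix.of fun i j : Fin 1 => if i.val + j.val + 1 = 1 then (1 : L) else 0)).Local v,
      Subgroup.centralizer ({γ} : Set ((UnitaryGroup.cmDatum L 2 (Matrix.of fun i j : Fin 2 => if i.val + j.val + 1 = 2 then (1 : L) else 0)).Local v ×
        (UnitaryGroup.cmDatum L 1 (Matrix.of fun i j : Fin 1 => if i.val + j.val + 1 = 1 then (1 : L) else 0)).Local v)) =
      (Subgroup.prod (G := (UnitaryGroup.cmDatum L 2 (Matrix.of fun i j : Fin 2 => if i.val + j.val + 1 = 2 then (1 : L) else 0)).Local v)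
          (N := (UnitaryGroup.cmDatum L 1 (Matrix.of fun i j : Fin 1 => if i.val + j.val + 1 = 1 then (1 : L) else 0)).Local v)
          (cmBorelTriple L 2 v).M ⊤).map (MulAut.conj u).toMonoidHom := by
  have hΩ : endoEmbLocal L v γ ∈ hyperbolicSet L v := by
    by_contra h
    exact hnc ((isCompact_centralizer_iff_not_mem_hyperbolicSet_H L v hns γ hγ).2 h)
  exact exists_centralizer_eq_map_splitTorusH_of_mem_hyperbolicSet L v hns γ hΩ

end Summit.HodgeConjecture.HodgeConjecture.Cruxes.H413.F0P3cStCharTSEllCartanCompactH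

end
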